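import Mathlib.NumberTheory.Zsqrtd.GaussianInt
import Mathlib.Tactic.NormNum
import HarnessLib

/-!
# Venture HSemireg — the EIGHT-TOWER SIGNED DESIGN at (g, d) = (4, 1) (ENGINE-W code A, SERVICE (α), RUNG 3 (i); the n = 2 CALIBRATION case, where DIAG(2,1) is TRUE):
# with κ = 2 + i (norm 5) and signs + on the μ₄-orbit of κ, − on the orbit of κ̄, the signed moment sums M_{p,q} = Σ_k s(k)·k^p·k̄^q over the eight elements of norm 5 of ℤ[i]
# VANISH for every (p, q) ∈ [0, 4]² other than the Weil corners (4, 0), (0, 4), where M_{4,0} = 192·i = −M_{0,4} — kernel arithmetic in ℤ[i]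

HONEST FRAMING. Lean index of the computation cell `pub-hsemireg`, widening group ENGINE-W (code A, seat `engine-w-1`, gen 18).
GAUSSIAN-INTEGER ARITHMETIC ONLY. What is NOT formalised: abelian varieties, the tower subschemes `𝕋_k`, their classes, D2's admissibility criterion (entered BY VALUE), or anything
object-level; nothing here says that HC, HC_CM, HC_AV or DIAG(n,d) holds. Theorems only (0 `def`, 0 named fact, 0 `sorry`). New namespace `EightTowerDesign`. Companion:
`TwelveTowerMomentDesign.lean` (#47; the (6, 3) design — same mechanism with μ₆).

SOURCE (the cell's own result, by value): ENGINE-W note `widen/ENGINE-W/out/p5alpha/P5-ALPHA-MOMENT-A.md` v1.1 §2 (C′) (service (α) for gs-eng-2 g38's «P5-OBS-R2» §5 RUNG 3 (i);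
vhodge memo ROUTE-P5-g2.md §3 D2: «Σ n_k [Γ_k] (+ any polynomial in θ₁, θ₂) is admissible iff M_{p,q} := Σ_k n_k σ(k)^p σ̄(k)^q = 0 for all (m+1)² − 4 non-corner (p,q) … u-component
M_{m,0}»; (α) (B): the same conditions decide the signed TOWER sums Σ n_k[𝕋_k]). MECHANISM (pencil): with signs antisymmetric under conjugation on ONE μ₄-orbit pair,
M_{p,q} = (κ^pκ̄^q − κ̄^pκ^q)·Σ_{ζ∈μ₄} ζ^{p−q}, and Σ_ζ ζ^{p−q} = 4·[4 ∣ p−q]: inside [0,4]² this leaves p = q (where the bracket vanishes) and the Weil corners — so at g = |μ_K| = 4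
ONE orbit pair suffices (as μ₆ does at g = 6, d = 3); M_{0,0} = M_{4,4} = 0: a pure u-plane class, u = 4(κ⁴ − κ̄⁴) = 192·i. The eight slopes (a, b) ↔ a + b·i with signs:
(−2,−1)+, (−2,1)−, (−1,−2)−, (−1,2)+, (1,−2)+, (1,2)−, (2,−1)−, (2,1)+. What the kernel holds:

* `moments_vanish` — for all `p, q < 5` with `(p,q) ∉ {(4,0), (0,4)}`: `Σ_i s_i·k_i^p·k̄_i^q = 0` in `ℤ[i]` (23 identities: D2's 21 non-corner conditions and the two Lefschetz corners). [kernel, `decide`]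
* `weil_corners` — the sums at `(4,0)` and `(0,4)` are `⟨0, 192⟩` and `⟨0, −192⟩`. [kernel, `decide`]
* `norms` — every slope has norm `5`. [kernel, `decide`]
-/

namespace Summit.Ventures.HSemireg.EightTowerDesign

/-- **All 23 non-Weil moment sums vanish** (`p, q < 5`, `(p,q) ≠ (4,0), (0,4)`). [kernel, `decide`] -/
theorem moments_vanish : ∀ p < 5, ∀ q < 5, ¬(p = 4 ∧ q = 0) → ¬(p = 0 ∧ q = 4) →
    (⟨-2, -1⟩ : GaussianInt) ^ p * (⟨-2, 1⟩ : GaussianInt) ^ q - (⟨-2, 1⟩ : GaussianInt) ^ p * (⟨-2, -1⟩ : GaussianInt) ^ q - (⟨-1, -2⟩ : GaussianInt) ^ p * (⟨-1, 2⟩ : GaussianInt) ^ q + (⟨-1, 2⟩ : GaussianInt) ^ p * (⟨-1, -2⟩ : GaussianInt) ^ q + (⟨1, -2⟩ : GaussianInt) ^ p * (⟨1, 2⟩ : GaussianInt) ^ q - (⟨1, 2⟩ : GaussianInt) ^ p * (⟨1, -2⟩ : GaussianInt) ^ q - (⟨2, -1⟩ : GaussianInt) ^ p * (⟨2, 1⟩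 : GaussianInt) ^ q + (⟨2, 1⟩ : GaussianInt) ^ p * (⟨2, -1⟩ : GaussianInt) ^ q = 0 := by
  decide

/-- **The Weil corners**: `(4,0) ↦ 192·i`, `(0,4) ↦ −192·i`. [kernel, `decide`] -/
theorem weil_corners :
    (let p := 4; let q := 0; (⟨-2, -1⟩ : GaussianInt) ^ p * (⟨-2, 1⟩ : GaussianInt) ^ q - (⟨-2, 1⟩ : GaussianInt) ^ p * (⟨-2, -1⟩ : GaussianInt) ^ q - (⟨-1, -2⟩ : GaussianInt) ^ p * (⟨-1, 2⟩ : GaussianInt) ^ q + (⟨-1, 2⟩ : GaussianInt) ^ p * (⟨-1, -2⟩ : GaussianInt) ^ q + (⟨1, -2⟩ : GaussianInt) ^ p * (⟨1, 2⟩ : GaussianInt) ^ q - (⟨1, 2⟩ : GaussianInt) ^ p * (⟨1, -2⟩ : GaussianInt) ^ q - (⟨2, -1⟩ : GaussianInt) ^ p * (⟨2, 1⟩ : GaussianInt) ^ q + (⟨2, 1⟩ : GaussianInt) ^ p * (⟨2, -1⟩ : GaussianInt) ^ q) = (⟨0, 192⟩ : GaussianInt) ∧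
    (let p := 0; let q := 4; (⟨-2, -1⟩ : GaussianInt) ^ p * (⟨-2, 1⟩ : GaussianInt) ^ q - (⟨-2, 1⟩ : GaussianInt) ^ p * (⟨-2, -1⟩ : GaussianInt) ^ q - (⟨-1, -2⟩ : GaussianInt) ^ p * (⟨-1, 2⟩ : GaussianInt) ^ q + (⟨-1, 2⟩ : GaussianInt) ^ p * (⟨-1, -2⟩ : GaussianInt) ^ q + (⟨1, -2⟩ : GaussianInt) ^ p * (⟨1, 2⟩ : GaussianInt) ^ q - (⟨1, 2⟩ : GaussianInt) ^ p * (⟨1, -2⟩ : GaussianInt) ^ q - (⟨2, -1⟩ : GaussianInt) ^ p * (⟨2, 1⟩ : GaussianInt) ^ q + (⟨2, 1⟩ : GaussianInt) ^ p * (⟨2, -1⟩ : GaussianInt) ^ q) = (⟨0, -192⟩ : GaussianInt) := by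
  decide

/-- **Norms**: `k·k̄ = 5` for the four orbit representatives (the other four are their negatives). [kernel, `decide`] -/
theorem norms :
    (⟨2, 1⟩ : GaussianInt) * ⟨2, -1⟩ = 5 ∧ (⟨1, 2⟩ : GaussianInt) * ⟨1, -2⟩ = 5 ∧ (⟨-1, 2⟩ : GaussianInt) * ⟨-1, -2⟩ = 5 ∧ (⟨-2, 1⟩ : GaussianInt) * ⟨-2, -1⟩ = 5 := by
  decide

end Summit.Ventures.HSemireg.EightTowerDesign
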